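import Literature.AlgebraicGeometry.Frobenioids.ArchimedeanQuotientLiftingProofs
import Literature.AlgebraicGeometry.Frobenioids.ArchimedeanIsoSubanchorIsotropy
import Literature.AlgebraicGeometry.Frobenioids.ArchimedeanFrobeniusAmple
import Literature.AlgebraicGeometry.Frobenioids.ArchimedeanArcPowers
import Literature.AlgebraicGeometry.Frobenioids.CircleOpensSubarcs
import HarnessLib

/-!
# Frobenioids II, Proposition 3.5 (ii) «⇒»: the arrows out of a non-isotropic object of `C` — tools

Mochizuki, *The geometry of Frobenioids II: poly-Frobenioids*, Kyushu J. Math. **62** (2008) 401–460,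
§3, Proposition 3.5 (ii) and its proof, kurims text p. 34 l. 46 – p. 35 l. 27
[cite: MochizukiFrdII2008, Prop 3.5 (ii) p.34]: "… `B_D` admits a morphism `B_D → C_D`, where `C_D` is an
RC-anchor … we conclude that it suffices to prove that `C` is an anchor of `F`, i.e., that the collection
of isomorphism classes of `^C F` arising from irreducible morphisms `C → C′` is finite. … `φ` is either a
pull-back morphism, an isometric pre-step, a co-angular pre-step …, or a prime-Frobenius morphism … the
finiteness … follows immediately from the fact that `C_D` is an anchor of `D[ℂ]` (respectively, from
Lemma 3.2, (v)) … from Lemma 3.2, (iii), (vii)."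

PROOF-ONLY companion (abc-iut cell, layer L1, node `FrdII:Prop3.5(ii)`, sub-rows P35-L04/L05; seat
abc-iut-w4-d092), part 1: the explicit arrows of `C = C₀ ×_{D₀} D` (Example 3.3) out of an object `X` used
to sort the irreducible arrows `X → Y` into the printed kinds, over ANY functor `π : D → D₀` —

* regions: `A^{⊗d}` and `c · A` as angular regions (`exists_powRegion`, `exists_smulRegion`), regions are
  determined by their point sets (`AngularRegion.eq_of_carrier_eq`), every angular part has a power equal
  to `S¹` (`AngularRegion.exists_pow_dir_eq_univ`, Lemma 3.2 (v)), and the intermediate-arc fact of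
  Lemma 3.2 (vi)(b) moved to `O_ℂ^×` (`NormOne.exists_strictly_between`);
* the pre-step `extHom : X → X_T` enlarging the region to `T ⊇ A_X` over the same base data, the
  Frobenius-type arrow `powHom : X → X^{(d)}` onto `A_X^{⊗d}`, and the "push-forward"
  `pushHom : X → X_h` along an arrow `h` of `D` into a complex object (same `C₀`-component);
* the factorisations `φ = powHom ≫ φ′` (`fac_pow`), `powHom = hull ≫ (𝟙, d, 1)` when `B^d = S¹`
  (`fac_hull_pow`), `φ = k ≫ liftMor` through the pull-back of `Y` along `φ_D` (`fac_lift`, with abc-iut-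
  w4-d100's `QuotientLift.liftMor`), and for linear `φ` the pre-step factorisation `φ = extHom ≫ j`
  (`fac_ext`, `j` invertible when `φ_D` is);
* the key rigidity `extHom_irreducible_imp`: an IRREDUCIBLE region enlargement of a non-isotropic object is
  its isotropic hull (tips: an intermediate tip; angular parts: an intermediate arc, Lemma 3.2 (vi)(b)).

Part 2 (`ArchimedeanNonIsotropicAnchors.lean`) assembles the anchor theorem and Prop. 3.5 (ii) «⇒».
No new definitions of record (the `def`s here are explicit witnesses used only by the proofs); no statement
of the paper is strengthened; nothing here bears on [IUTchIII] Cor. 3.12.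
-/

namespace Literature.AlgebraicGeometry.Frobenioids

open CategoryTheory Set
open scoped Pointwise

noncomputable section

universe v u

namespace ArchFrd

/-! ### Angular regions: determined by their point sets; powers; scalings -/

namespace AngularRegion

/-- Two angular regions of `ℂ^×` with the same angular part and tip are equal.
[cite: MochizukiFrdII2008, Def 3.1 (iii) p.24] -/
theorem ext' {A A' : AngularRegion ℂ} (hd : A.dir = A'.dir) (ht : A.tip = A'.tip) : A = A' := by
  cases A; cases A'; cases hd; cases ht; rfl

/-- The tip of an angular region is read off its point set. [cite: MochizukiFrdII2008, Def 3.1 (iii) p.24] -/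
theorem tip_le_of_carrier_subset {A A' : AngularRegion ℂ} (h : A.carrier ⊆ A'.carrier) : A.tip ≤ A'.tip := by
  obtain ⟨z, hz⟩ := A.dir_nonempty
  have hm : (z : ℂˣ) * ofPosReal ℂ A.tip ∈ A'.carrier :=
    h ((A.coe_mul_ofPosReal_mem_carrier_iff z A.tip).2 ⟨hz, le_rfl⟩)
  exact ((A'.coe_mul_ofPosReal_mem_carrier_iff z A.tip).1 hm).2

/-- The angular part of an angular region is read off its point set.
[cite: MochizukiFrdII2008, Def 3.1 (iii) p.24] -/
theorem dir_subset_of_carrier_subset {A A' : AngularRegion ℂ} (h : A.carrier ⊆ A'.carrier) :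
    A.dir ⊆ A'.dir := by
  rw [← A.image_unitPart_carrier, ← A'.image_unitPart_carrier]
  exact image_mono h

/-- An angular region is determined by its point set. [cite: MochizukiFrdII2008, Def 3.1 (iii) p.24] -/
theorem eq_of_carrier_eq {A A' : AngularRegion ℂ} (h : A.carrier = A'.carrier) : A = A' :=
  ext' ((dir_subset_of_carrier_subset h.le).antisymm (dir_subset_of_carrier_subset h.ge))
    (le_antisymm (tip_le_of_carrier_subset h.le) (tip_le_of_carrier_subset h.ge))

/-- Inclusion of point sets from inclusion of angular parts and comparison of tips.
[cite: MochizukiFrdII2008, Def 3.1 (iii) p.24] -/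
theorem carrier_subset_of {A A' : AngularRegion ℂ} (hd : A.dir ⊆ A'.dir) (ht : A.tip ≤ A'.tip) :
    A.carrier ⊆ A'.carrier := fun u hu =>
  (A'.mem_carrier_polar_iff u).2 ⟨hd ((A.mem_carrier_polar_iff u).1 hu).1,
    ((A.mem_carrier_polar_iff u).1 hu).2.trans ht⟩

/-- **`A^{⊗d}` is an angular region** (Def. 3.1 (iii), last sentence): angular part `B^d`, tip `λ^d`, point
set `A^d` (`d = n + 1 ≥ 1`). [cite: MochizukiFrdII2008, Def 3.1 (iii) p.24] -/
theorem exists_powRegion (A : AngularRegion ℂ) (n : ℕ) :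
    ∃ A' : AngularRegion ℂ, A'.dir = A.dir ^ (n + 1) ∧ A'.tip = A.tip ^ (n + 1) ∧
      A'.carrier = A.carrier ^ (n + 1) := by
  obtain ⟨A', hd, ht⟩ := exists_angularRegion (isOpen_pow A.isOpen_dir n)
    (isConnected_pow A.isConnected_dir n) (A.tip ^ (n + 1))
  refine ⟨A', hd, ht, ?_⟩
  have h := C0.smul_carrier_pow_eq A A' 1 n (by rw [unitPart_one, one_smul, hd]) (by rw [map_one, one_mul, ht])
  rw [one_smul] at h
  exact h.symm

/-- **`c · A` is an angular region**: angular part `(c/|c|) · B`, tip `|c| · λ`.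
[cite: MochizukiFrdII2008, Ex 3.3 (i) p.27] -/
theorem exists_smulRegion (A : AngularRegion ℂ) (c : ℂˣ) :
    ∃ A' : AngularRegion ℂ, A'.dir = unitPart ℂ c • A.dir ∧ A'.tip = absHom ℂ c * A.tip ∧
      A'.carrier = c • A.carrier := by
  obtain ⟨A', hd, ht⟩ := exists_angularRegion (isOpen_smul (unitPart ℂ c) A.isOpen_dir)
    (isConnected_smul (unitPart ℂ c) A.isConnected_dir) (absHom ℂ c * A.tip)
  refine ⟨A', hd, ht, ?_⟩
  have h := C0.smul_carrier_pow_eq A A' c 0 (by rw [zero_add, pow_one, hd]) (by rw [zero_add, pow_one, ht])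
  rw [zero_add, pow_one] at h
  exact h.symm

/-- **Lemma 3.2 (v) for angular parts**: some power onwards, `B^d = S¹` ("for `n ∈ ℤ ∖ E`, `φ_n(A) = S¹`").
[cite: MochizukiFrdII2008, Lem 3.2 (v) p.25] -/
theorem exists_pow_dir_eq_univ (A : AngularRegion ℂ) :
    ∃ N : ℕ, ∀ n : ℕ, N ≤ n → A.dir ^ (n + 1) = univ := by
  by_cases hA : A.IsIsotropic
  · refine ⟨0, fun n _ => ?_⟩
    rw [show A.dir = univ from hA]
    exact Set.univ_pow (Nat.succ_ne_zero n)
  · obtain ⟨c, d, hcd, -, hB'⟩ := CircleOpens.exists_eq_exp_image_Ioo (isConnected_image_dir A)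
      (isOpen_image_dir A) (image_dir_ne_univ A hA)
    obtain ⟨N, hN⟩ := exists_nat_gt (2 * Real.pi / (d - c))
    have hdc : 0 < d - c := by linarith
    refine ⟨N, fun n hn => eq_univ_of_forall fun w => ?_⟩
    have hn1 : 2 * Real.pi / (d - c) < (n + 1 : ℕ) := by
      have : (N : ℝ) ≤ n := by exact_mod_cast hn
      push_cast
      linarith
    have hlen : 2 * Real.pi < ((n + 1 : ℕ) : ℝ) * d - ((n + 1 : ℕ) : ℝ) * c := by
      rw [← mul_sub]; rwa [div_lt_iff₀ hdc] at hn1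
    have hw : toCircleHom w ∈ Circle.exp '' Ioo (((n + 1 : ℕ) : ℝ) * c) (((n + 1 : ℕ) : ℝ) * d) := by
      rw [CircleOpens.exp_image_Ioo_eq_univ hlen]; trivial
    obtain ⟨x, hx, hxw⟩ := hw
    have hnr : (0 : ℝ) < ((n + 1 : ℕ) : ℝ) := by positivity
    have hy : x / ((n + 1 : ℕ) : ℝ) ∈ Ioo c d :=
      ⟨by rw [lt_div_iff₀ hnr]; linarith [hx.1], by rw [div_lt_iff₀ hnr]; linarith [hx.2]⟩
    have hmem : Circle.exp (x / ((n + 1 : ℕ) : ℝ)) ∈ toCircleHom '' A.dir := by rw [hB']; exact ⟨_, hy, rfl⟩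
    obtain ⟨z, hz, hzexp⟩ := hmem
    have hzw : z ^ (n + 1) = w := by
      refine toCircleHom_injective ?_
      rw [map_pow, hzexp, ← circleExp_nat_mul, mul_div_cancel₀ _ hnr.ne', hxw]
    rw [← hzw, NormOne.pow_eq_image_pow A.isConnected_dir A.isOpen_dir (Nat.succ_pos n)]
    exact ⟨z, hz, rfl⟩

end AngularRegion

/-! ### Lemma 3.2 (vi)(b) on `O_ℂ^×`: an intermediate connected open between `B ⊊ B′ ≠ S¹` -/

/-- **Intermediate arcs** (Lemma 3.2 (vi)(b), via `CircleOpens.condB_of_arc`): if `B ⊊ B′` are connected open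
subsets of `O_ℂ^×` and `B′ ≠ O_ℂ^×`, some connected open `B₃` lies strictly between them.
[cite: MochizukiFrdII2008, Lem 3.2 (vi)(b) p.26] -/
theorem NormOne.exists_strictly_between {B B' : Set ↥(normOneSubgroup ℂ)} (hB : IsConnected B)
    (hBo : IsOpen B) (hB' : IsConnected B') (hB'o : IsOpen B') (hsub : B ⊆ B') (hne : B ≠ B')
    (hB'u : B' ≠ univ) :
    ∃ B₃ : Set ↥(normOneSubgroup ℂ), IsConnected B₃ ∧ IsOpen B₃ ∧ B ⊆ B₃ ∧ B₃ ⊆ B' ∧ B₃ ≠ B ∧ B₃ ≠ B' := by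
  -- move to `Circle`
  have himo : ∀ S : Set ↥(normOneSubgroup ℂ), IsOpen S → IsOpen (toCircleHom '' S) := fun S hS => by
    rw [image_toCircleHom_eq_preimage]; exact hS.preimage continuous_fromCircle
  have hA : IsConnected (toCircleHom '' B) := hB.image _ continuous_toCircleHom.continuousOn
  have hA' : IsConnected (toCircleHom '' B') := hB'.image _ continuous_toCircleHom.continuousOn
  have hAA' : toCircleHom '' B ⊆ toCircleHom '' B' := image_mono hsub
  have hAne : toCircleHom '' B ≠ toCircleHom '' B' := fun h =>
    hne ((image_injective.mpr toCircleHom_injective) h)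
  have hA'u : toCircleHom '' B' ≠ univ := by
    intro h
    apply hB'u
    refine eq_univ_of_forall fun z => ?_
    have hz : toCircleHom z ∈ toCircleHom '' B' := by rw [h]; trivial
    obtain ⟨z', hz', e⟩ := hz
    rwa [← toCircleHom_injective e]
  -- both are arcs in one period
  obtain ⟨c, d, hcd, hdc, hB'eq⟩ := CircleOpens.exists_eq_exp_image_Ioo hA' (himo B' hB'o) hA'u
  have hcA : Circle.exp c ∉ toCircleHom '' B := fun h =>
    CircleOpens.exp_left_notMem_exp_image_Ioo hdc (hB'eq ▸ hAA' h)
  obtain ⟨a, b, hca, hab, hb2, hBeq⟩ := CircleOpens.exists_eq_exp_image_Ioo_of_notMem hA (himo B hBo) hcA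
  have hsub' := hAA'
  rw [hBeq, hB'eq] at hsub'
  have hbd := ((CircleOpens.exp_image_Ioo_subset_iff hab hca hb2 le_rfl (by linarith)).mp hsub').2
  have hset : CircleOpens.Setting (toCircleHom '' B) (toCircleHom '' B') :=
    ⟨hA, himo B hBo, hA', himo B' hB'o, hAA'⟩
  obtain ⟨C, ⟨hC, hCo, hAC, hCA'⟩, hCA, hCB⟩ :=
    (hBeq ▸ hB'eq ▸ CircleOpens.condB_of_arc hdc hca hab hbd) _ _ (CircleOpens.isSub_left hset)
      (CircleOpens.isSub_right hset) hAA' hAne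
  -- move back
  refine ⟨fromCircle '' C, hC.image _ continuous_fromCircle.continuousOn, ?_, ?_, ?_, ?_, ?_⟩
  · have : fromCircle '' C = toCircleHom ⁻¹' C := by
      ext z; constructor
      · rintro ⟨w, hw, rfl⟩; change toCircleHom (fromCircle w) ∈ C; rwa [toCircleHom_fromCircle]
      · intro hz; exact ⟨toCircleHom z, hz, fromCircle_toCircleHom z⟩
    rw [this]; exact hCo.preimage continuous_toCircleHom
  · intro z hz
    exact ⟨toCircleHom z, hAC ⟨z, hz, rfl⟩, fromCircle_toCircleHom z⟩
  · rintro _ ⟨w, hw, rfl⟩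
    obtain ⟨z, hz, hzw⟩ := hCA' hw
    rwa [← hzw, fromCircle_toCircleHom]
  · intro h
    apply hCA
    rw [← h, image_image]
    simp only [toCircleHom_fromCircle, image_id']
  · intro h
    apply hCB
    rw [← h, image_image]
    simp only [toCircleHom_fromCircle, image_id']

variable {D : Type u} [Category.{v} D] (π : D ⥤ D0)

namespace NonIso

/-! ### Region enlargements `X → X_T` (pre-steps over the same base data) -/

/-- `X_T`: the object of `C` with the base data of `X` and the larger angular region `T ⊇ A_X`.
[cite: MochizukiFrdII2008, Prop 3.5 (ii) p.34] -/
abbrev extObj (X : C π) (T : AngularRegion ℂ) (hT : X.fst.region.dir ⊆ T.dir) : C π :=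
  ⟨⟨X.fst.base, T, fun h => eq_univ_of_univ_subset
      ((show X.fst.region.dir = univ from X.fst.isIsotropic_of_isReal h) ▸ hT)⟩, X.snd, X.iso⟩

/-- The pre-step `(𝟙, 1, 1) : X → X_T`. [cite: MochizukiFrdII2008, Prop 3.5 (ii) p.34] -/
def extHom (X : C π) (T : AngularRegion ℂ) (hT : X.fst.region.dir ⊆ T.dir) (ht : X.fst.region.tip ≤ T.tip) :
    X ⟶ extObj π X T hT where
  fst :=
    { base := 𝟙 _, degFr := 1, scalar := 1, scalar_mem := one_mem _,
      mapsTo := by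
        rw [PNat.one_coe, pow_one, one_smul]
        change X.fst.region.carrier ⊆ C0.pullRegion ⟨X.fst.base, T, _⟩ (𝟙 X.fst.base)
        rw [C0.pullRegion_id]
        exact AngularRegion.carrier_subset_of hT ht }
  snd := 𝟙 X.snd
  w := by
    change 𝟙 _ ≫ X.iso.hom = X.iso.hom ≫ π.map (𝟙 X.snd)
    rw [CategoryTheory.Functor.map_id, Category.id_comp, Category.comp_id]

/-- The pre-step `(𝟙, 1, 1) : X_{T₁} → X_{T₂}` for `T₁ ⊆ T₂`. [cite: MochizukiFrdII2008, Prop 3.5 (ii) p.34] -/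
def extHom₂ (X : C π) (T₁ T₂ : AngularRegion ℂ) (h₁ : X.fst.region.dir ⊆ T₁.dir)
    (h₂ : X.fst.region.dir ⊆ T₂.dir) (hd : T₁.dir ⊆ T₂.dir) (ht : T₁.tip ≤ T₂.tip) :
    extObj π X T₁ h₁ ⟶ extObj π X T₂ h₂ where
  fst :=
    { base := 𝟙 _, degFr := 1, scalar := 1, scalar_mem := one_mem _,
      mapsTo := by
        rw [PNat.one_coe, pow_one, one_smul]
        change T₁.carrier ⊆ C0.pullRegion ⟨X.fst.base, T₂, _⟩ (𝟙 X.fst.base)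
        rw [C0.pullRegion_id]
        exact AngularRegion.carrier_subset_of hd ht }
  snd := 𝟙 X.snd
  w := by
    change 𝟙 _ ≫ X.iso.hom = X.iso.hom ≫ π.map (𝟙 X.snd)
    rw [CategoryTheory.Functor.map_id, Category.id_comp, Category.comp_id]

/-- `X → X_{T₂}` factors through `X_{T₁}` for `A_X ⊆ T₁ ⊆ T₂`. [cite: MochizukiFrdII2008, Prop 3.5 (ii) p.34] -/
theorem extHom_fac (X : C π) (T₁ T₂ : AngularRegion ℂ) (h₁ : X.fst.region.dir ⊆ T₁.dir)
    (ht₁ : X.fst.region.tip ≤ T₁.tip) (h₂ : X.fst.region.dir ⊆ T₂.dir) (hd : T₁.dir ⊆ T₂.dir)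
    (ht : T₁.tip ≤ T₂.tip) :
    extHom π X T₁ h₁ ht₁ ≫ extHom₂ π X T₁ T₂ h₁ h₂ hd ht = extHom π X T₂ h₂ (ht₁.trans ht) := by
  refine CFP.hom_ext (C0.hom_ext (Category.id_comp _) rfl ?_) (Category.id_comp _)
  change D0.Hom.act (𝟙 X.fst.base) (1 : ℂˣ) * 1 ^ ((1 : ℕ+) : ℕ) = 1
  rw [map_one, one_pow, mul_one]

/-- If `X → X_T` is an isomorphism then `T = A_X`. [cite: MochizukiFrdII2008, Prop 3.5 (ii) p.34] -/
theorem eq_of_isIso_extHom (X : C π) (T : AngularRegion ℂ) (hT : X.fst.region.dir ⊆ T.dir)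
    (ht : X.fst.region.tip ≤ T.tip) [IsIso (extHom π X T hT ht)] : X.fst.region = T := by
  haveI : IsIso (extHom π X T hT ht).fst := CFP.isIso_fst _
  have h := (C0.of_isIso (extHom π X T hT ht).fst).2.2
  change (1 : ℂˣ) • X.fst.region.carrier = C0.pullRegion ⟨X.fst.base, T, _⟩ (𝟙 X.fst.base) at h
  rw [one_smul, C0.pullRegion_id] at h
  exact AngularRegion.eq_of_carrier_eq h

/-- If `X_{T₁} → X_{T₂}` is an isomorphism then `T₁ = T₂`. [cite: MochizukiFrdII2008, Prop 3.5 (ii) p.34] -/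
theorem eq_of_isIso_extHom₂ (X : C π) (T₁ T₂ : AngularRegion ℂ) (h₁ : X.fst.region.dir ⊆ T₁.dir)
    (h₂ : X.fst.region.dir ⊆ T₂.dir) (hd : T₁.dir ⊆ T₂.dir) (ht : T₁.tip ≤ T₂.tip)
    [IsIso (extHom₂ π X T₁ T₂ h₁ h₂ hd ht)] : T₁ = T₂ := by
  haveI : IsIso (extHom₂ π X T₁ T₂ h₁ h₂ hd ht).fst := CFP.isIso_fst _
  have h := (C0.of_isIso (extHom₂ π X T₁ T₂ h₁ h₂ hd ht).fst).2.2
  change (1 : ℂˣ) • T₁.carrier = C0.pullRegion ⟨X.fst.base, T₂, _⟩ (𝟙 X.fst.base) at h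
  rw [one_smul, C0.pullRegion_id] at h
  exact AngularRegion.eq_of_carrier_eq h

/-- **Irreducible region enlargements are isotropic hulls.** If `X` is not naively isotropic and the pre-step
`X → X_T` is irreducible, then `T = (O_ℂ^×, tip(X))`: a larger tip admits an intermediate tip, and a proper
larger angular part `≠ S¹` admits an intermediate arc (Lemma 3.2 (vi)(b)) — both give factorisations into
two non-isomorphisms. [cite: MochizukiFrdII2008, Prop 3.5 (ii) p.34] -/
theorem extHom_irreducible_imp (X : C π) (T : AngularRegion ℂ) (hT : X.fst.region.dir ⊆ T.dir)
    (ht : X.fst.region.tip ≤ T.tip) (hirr : IsIrreducibleHom (extHom π X T hT ht)) :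
    T = AngularRegion.isotropicOfTip X.fst.region.tip := by
  set R := X.fst.region with hR
  -- the tip of `T` is the tip of `X`
  have htip : T.tip = R.tip := by
    refine le_antisymm (not_lt.mp fun hlt => ?_) ht
    by_cases hdir : R.dir = T.dir
    · -- intermediate tip
      let t' : PosReal := ⟨((R.tip : ℝ) + T.tip) / 2, by have := R.tip.2; have := T.tip.2; positivity⟩
      have h1 : R.tip < t' := by
        change (R.tip : ℝ) < ((R.tip : ℝ) + T.tip) / 2
        have : (R.tip : ℝ) < T.tip := hlt
        linarith
      have h2 : t' < T.tip := by
        change ((R.tip : ℝ) + T.tip) / 2 < (T.tip : ℝ)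
        have : (R.tip : ℝ) < T.tip := hlt
        linarith
      obtain ⟨T₁, hT₁d, hT₁t⟩ := exists_angularRegion R.isOpen_dir R.isConnected_dir t'
      have hfac := extHom_fac π X T₁ T hT₁d.ge (hT₁t ▸ h1.le) hT (hT₁d.le.trans hdir.le) (hT₁t ▸ h2.le)
      rcases hirr.2 _ _ hfac with hi | hi
      · haveI := hi
        have := eq_of_isIso_extHom₂ π X T₁ T hT₁d.ge hT (hT₁d.le.trans hdir.le) (hT₁t ▸ h2.le)
        exact h2.ne (hT₁t ▸ congrArg AngularRegion.tip this)
      · haveI := hi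
        have := eq_of_isIso_extHom π X T₁ hT₁d.ge (hT₁t ▸ h1.le)
        exact h1.ne ((congrArg AngularRegion.tip this).trans hT₁t)
    · -- enlarge the angular part first, then the tip
      obtain ⟨T₁, hT₁d, hT₁t⟩ := exists_angularRegion T.isOpen_dir T.isConnected_dir R.tip
      have hfac := extHom_fac π X T₁ T (hT₁d ▸ hT) (hT₁t ▸ le_rfl) hT hT₁d.le (hT₁t ▸ ht)
      rcases hirr.2 _ _ hfac with hi | hi
      · haveI := hi
        have := eq_of_isIso_extHom₂ π X T₁ T (hT₁d ▸ hT) hT hT₁d.le (hT₁t ▸ ht)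
        exact hlt.ne ((hT₁t.symm.trans (congrArg AngularRegion.tip this)))
      · haveI := hi
        have := eq_of_isIso_extHom π X T₁ (hT₁d ▸ hT) (hT₁t ▸ le_rfl)
        exact hdir ((congrArg AngularRegion.dir this).trans hT₁d)
  -- the angular part of `T` is everything
  have hdir : T.dir = univ := by
    by_contra hTu
    have hne : R.dir ≠ T.dir := fun h => hirr.1 (by
      have hRT : R = T := AngularRegion.ext' h htip.symm
      haveI : IsIso (C0.Base (extHom π X T hT ht).fst) := by
        change IsIso (𝟙 X.fst.base); infer_instance
      haveI : IsIso (extHom π X T hT ht).fst := by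
        refine C0.isIso_of _ rfl ?_
        change (1 : ℂˣ) • R.carrier = C0.pullRegion ⟨X.fst.base, T, _⟩ (𝟙 X.fst.base)
        rw [one_smul, C0.pullRegion_id, hRT]
      haveI : IsIso (extHom π X T hT ht).snd := by change IsIso (𝟙 X.snd); infer_instance
      exact CFP.isIso_of_isIso_fst_snd _)
    obtain ⟨B₃, hB₃c, hB₃o, hRB₃, hB₃T, hB₃R, hB₃T'⟩ :=
      NormOne.exists_strictly_between R.isConnected_dir R.isOpen_dir T.isConnected_dir T.isOpen_dir hT hne hTu
    obtain ⟨T₁, hT₁d, hT₁t⟩ := exists_angularRegion hB₃o hB₃c R.tip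
    have hfac := extHom_fac π X T₁ T (hT₁d ▸ hRB₃) (hT₁t ▸ le_rfl) hT (hT₁d ▸ hB₃T) (hT₁t ▸ ht)
    rcases hirr.2 _ _ hfac with hi | hi
    · haveI := hi
      have := eq_of_isIso_extHom₂ π X T₁ T (hT₁d ▸ hRB₃) hT (hT₁d ▸ hB₃T) (hT₁t ▸ ht)
      exact hB₃T' (hT₁d.symm.trans (congrArg AngularRegion.dir this))
    · haveI := hi
      have := eq_of_isIso_extHom π X T₁ (hT₁d ▸ hRB₃) (hT₁t ▸ le_rfl)
      exact hB₃R (hT₁d.symm.trans (congrArg AngularRegion.dir this).symm)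
  exact AngularRegion.ext' hdir htip

end NonIso

end ArchFrd

end

end Literature.AlgebraicGeometry.Frobenioids
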